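import Mathlib
import HarnessLib
import Summits.HubbardSuperconductivity.HubbardSuperconductivity.Theorems.KLProgrammeKLRegimeTwoVolumeNormVKit

/-!
# Route `KLProgramme` — crux K3, VL child `KLRegimeVolumeLimitV17F2` (stmt-HubbardSuperconductivity-20440), blueprint v5 M5: THE PER-SCALE TWO-VOLUME BOUND IN
# THE SPINE'S LINEAR FORM (seat hubbard-kl-k3c4-p1 g12; `--supports` 20440)

The limit spine `…TwoVolumeDefectSupSpine.defectSup_eventually_le` (p590681) consumes the per-scale step as a LINEAR form
`KE·‖Ein‖ + KD·(φRd)⁻¹ + KTe·Te + KT·T + KRf·(Rf)⁻¹` with volume-free coefficients.  The per-scale bound of record (`…SrcSectorScaleSuccMinS/Bundled`, after the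
ε-normalisation `…StepEpsHomog.minS_rhs_eps_homog`) is literally of that shape, except that its five coefficients contain the field-weighted norms `normV Γ′ …` of
the one-volume profiles over the FINE label type `Γ′` (whose cardinality grows with the volume).  This file replaces them by any volume-free majorants
`ν₁ … ν₅` (in the model: the sums of the budget series), under the barred smallness conditions: **`minS_rhs_le_linear`**.  Pure real algebra (monotonicity of
the Gawȩdzki–Kupiainen brackets `x ↦ c·x/(1−θ(x))`, `x ↦ c/(1−θ(x))²` in the norms); no definition.
-/

noncomputable section

namespace Summit.HubbardSuperconductivity.HubbardSuperconductivity.Theorems.TwoVolumeDefect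

set_option linter.dupNamespace false -- summit = problem name (single-conjunct summit), D-0017

open Finset Literature.MathematicalPhysics.QuantumLattice

/-- The Gawȩdzki–Kupiainen bracket `A/(1−t)²` is monotone in the smallness number `t < 1` (`A ≥ 0`). [folklore] -/
theorem div_one_sub_sq_mono {A t tb : ℝ} (hA : 0 ≤ A) (ht : t ≤ tb) (htb : tb < 1) : A / (1 - t) ^ 2 ≤ A / (1 - tb) ^ 2 :=
  div_le_div_of_nonneg_left hA (by nlinarith) (by nlinarith)

/-- The Gawȩdzki–Kupiainen bracket `A/(1−t)` is monotone in `(A, t)`, `t < 1`, `A ≥ 0`. [folklore] -/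
theorem div_one_sub_mono {A Ab t tb : ℝ} (hA : 0 ≤ A) (hAb : A ≤ Ab) (ht : t ≤ tb) (htb : tb < 1) : A / (1 - t) ≤ Ab / (1 - tb) :=
  div_le_div₀ (hA.trans hAb) hAb (by linarith) (by linarith)

/-- **THE PER-SCALE BOUND IN LINEAR FORM WITH VOLUME-FREE COEFFICIENTS.**  If the five field-weighted norms of the one-volume profiles entering MinS's
right-hand side are `≤ ν₁ … ν₅` and the barred smallness numbers are `< 1`, then MinS's right-hand side (ε-normalised, `…StepEpsHomog`) is at most
`KE·normV Γ′ κ′ ρ′ Ein + KD·(1+Λ(R′+1))⁻¹ + KTe·(eW′/(1+Λ(R+1))) + KT·(αW′/(1+Λ(R+1))) + KRf·(Λ(R′+1))⁻¹` with the displayed `ν`-coefficients — the `hrec` shape of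
`…TwoVolumeDefectSupSpine.defectSup_eventually_le`. [folklore: monotonicity of the Gawȩdzki–Kupiainen brackets; cite: BenfattoGiulianiMastropietro2006, (2.77)-(2.80)] -/
theorem minS_rhs_le_linear (Γ' : Type) [Fintype Γ'] (n : ℕ) {aW aW' sW sW' eW' κ κ' ρ' ρ₂ ρf Λ νEbar ν₁ ν₂ ν₃ ν₄ ν₅ : ℝ} (R R' : ℕ)
    {NV NW' Nw Ein : ℕ → ℝ} (hκ : 0 ≤ κ) (hκ' : 0 ≤ κ') (hρ' : 0 < ρ') (hρ₂ : 0 < ρ₂) (hρf : 0 < ρf) (haW : 0 ≤ aW) (haW' : 0 ≤ aW')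
    (hsW : 0 ≤ sW) (hsW' : 0 ≤ sW') (heW' : 0 ≤ eW') (hΛ : 0 ≤ Λ)
    (hNV : ∀ m', 0 ≤ NV m') (hNW' : ∀ m', 0 ≤ NW' m') (hNw : ∀ m', 0 ≤ Nw m') (hEin : ∀ m', 0 ≤ Ein m')
    (hν₁ : normV Γ' κ' ρ' (fun m' => NV m' + (NW' m' + NV m')) ≤ ν₁) (hν₂ : normV Γ' κ' ρ' (fun m' => NW' m' + NV m') ≤ ν₂)
    (hν₃ : normV Γ' κ' ρ' NV ≤ ν₃) (hν₄ : normV Γ' (κ' + κ + (κ' + κ + (κ' + κ))) ρ₂ Nw ≤ ν₄) (hν₅ : normV Γ' (κ' + κ) ρf Nw ≤ ν₅)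
    (hθ₁ : Real.exp 1 * aW' * (ν₁ + νEbar) / κ' ^ 2 < 1) (hθ₂ : Real.exp 1 * aW' * (ν₃ + ν₂) / κ' ^ 2 < 1)
    (hθ₃ : Real.exp 1 * (aW' + aW + (aW' + aW)) * ν₄ / (κ' + κ + (κ' + κ + (κ' + κ))) ^ 2 < 1)
    (hθf : Real.exp 1 * (aW' + aW + (aW' + aW)) * ν₅ / (κ' + κ) ^ 2 < 1) :
    (ρ'⁻¹ ^ (n + 1) * Real.exp 1 / (1 - Real.exp 1 * aW' * (normV Γ' κ' ρ' (fun m' => NV m' + (NW' m' + NV m')) + νEbar) / κ' ^ 2) ^ 2) * normV Γ' κ' ρ' Ein +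
        (ρ'⁻¹ ^ (n + 1) * (Real.exp 1 * normV Γ' κ' ρ' (fun m' => NW' m' + NV m')) / (1 - Real.exp 1 * aW' * (normV Γ' κ' ρ' NV + normV Γ' κ' ρ' (fun m' => NW' m' + NV m')) / κ' ^ 2) ^ 2) * (1 + Λ * ((R' : ℝ) + 1))⁻¹ +
        ((((n + 1 + 1) * (n + 1 + 2) : ℕ) : ℝ) / 2 *
            (ρ₂⁻¹ ^ (n + 3) * (Real.exp 1 * normV Γ' (κ' + κ + (κ' + κ + (κ' + κ))) ρ₂ Nw) / (1 - Real.exp 1 * (aW' + aW + (aW' + aW)) * normV Γ' (κ' + κ + (κ' + κ + (κ' + κ))) ρ₂ Nw / (κ' + κ + (κ' + κ + (κ' + κ))) ^ 2))) * (eW' / (1 + Λ * ((R : ℝ) + 1))) +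
        (‖(2 : ℂ)⁻¹‖ * ∑ a ∈ range (n + 2), ∑ b ∈ range (n + 2),
            (if a + b = n + 1 then (((a + 1) * (b + 1) : ℕ) : ℝ) *
              (4 * (ρ₂⁻¹ ^ (a + 1) * (Real.exp 1 * normV Γ' (κ' + κ + (κ' + κ + (κ' + κ))) ρ₂ Nw) / (1 - Real.exp 1 * (aW' + aW + (aW' + aW)) * normV Γ' (κ' + κ + (κ' + κ + (κ' + κ))) ρ₂ Nw / (κ' + κ + (κ' + κ + (κ' + κ))) ^ 2)) *
                (ρ₂⁻¹ ^ (b + 1) * (Real.exp 1 * normV Γ' (κ' + κ + (κ' + κ + (κ' + κ))) ρ₂ Nw) / (1 - Real.exp 1 * (aW' + aW + (aW' + aW)) * normV Γ' (κ' + κ + (κ' + κ + (κ' + κ))) ρ₂ Nw / (κ' + κ + (κ' + κ + (κ' + κ))) ^ 2))) else 0)) * (aW' / (1 + Λ * ((R : ℝ) + 1))) +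
        ((((n + 1 + 1) * (n + 1 + 2) : ℕ) : ℝ) / 2 * (sW' + sW) *
              (ρf⁻¹ ^ (n + 3) * (Real.exp 1 * normV Γ' (κ' + κ) ρf Nw) / (1 - Real.exp 1 * (aW' + aW + (aW' + aW)) * normV Γ' (κ' + κ) ρf Nw / (κ' + κ) ^ 2)) +
            ‖(2 : ℂ)⁻¹‖ * ∑ a ∈ range (n + 2), ∑ b ∈ range (n + 2),
              (if a + b = n + 1 then (((a + 1) * (b + 1) : ℕ) : ℝ) *
                (2 * (aW' + aW) * (ρf⁻¹ ^ (a + 1) * (Real.exp 1 * normV Γ' (κ' + κ) ρf Nw) / (1 - Real.exp 1 * (aW' + aW + (aW' + aW)) * normV Γ' (κ' + κ) ρf Nw / (κ' + κ) ^ 2)) *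
                  (ρf⁻¹ ^ (b + 1) * (Real.exp 1 * normV Γ' (κ' + κ) ρf Nw) / (1 - Real.exp 1 * (aW' + aW + (aW' + aW)) * normV Γ' (κ' + κ) ρf Nw / (κ' + κ) ^ 2))) else 0)) * (Λ * ((R' : ℝ) + 1))⁻¹ ≤
      (ρ'⁻¹ ^ (n + 1) * Real.exp 1 / (1 - Real.exp 1 * aW' * (ν₁ + νEbar) / κ' ^ 2) ^ 2) * normV Γ' κ' ρ' Ein +
        (ρ'⁻¹ ^ (n + 1) * (Real.exp 1 * ν₂) / (1 - Real.exp 1 * aW' * (ν₃ + ν₂) / κ' ^ 2) ^ 2) * (1 + Λ * ((R' : ℝ) + 1))⁻¹ +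
        ((((n + 1 + 1) * (n + 1 + 2) : ℕ) : ℝ) / 2 *
            (ρ₂⁻¹ ^ (n + 3) * (Real.exp 1 * ν₄) / (1 - Real.exp 1 * (aW' + aW + (aW' + aW)) * ν₄ / (κ' + κ + (κ' + κ + (κ' + κ))) ^ 2))) * (eW' / (1 + Λ * ((R : ℝ) + 1))) +
        (‖(2 : ℂ)⁻¹‖ * ∑ a ∈ range (n + 2), ∑ b ∈ range (n + 2),
            (if a + b = n + 1 then (((a + 1) * (b + 1) : ℕ) : ℝ) *
              (4 * (ρ₂⁻¹ ^ (a + 1) * (Real.exp 1 * ν₄) / (1 - Real.exp 1 * (aW' + aW + (aW' + aW)) * ν₄ / (κ' + κ + (κ' + κ + (κ' + κ))) ^ 2)) *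
                (ρ₂⁻¹ ^ (b + 1) * (Real.exp 1 * ν₄) / (1 - Real.exp 1 * (aW' + aW + (aW' + aW)) * ν₄ / (κ' + κ + (κ' + κ + (κ' + κ))) ^ 2))) else 0)) * (aW' / (1 + Λ * ((R : ℝ) + 1))) +
        ((((n + 1 + 1) * (n + 1 + 2) : ℕ) : ℝ) / 2 * (sW' + sW) *
              (ρf⁻¹ ^ (n + 3) * (Real.exp 1 * ν₅) / (1 - Real.exp 1 * (aW' + aW + (aW' + aW)) * ν₅ / (κ' + κ) ^ 2)) +
            ‖(2 : ℂ)⁻¹‖ * ∑ a ∈ range (n + 2), ∑ b ∈ range (n + 2),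
              (if a + b = n + 1 then (((a + 1) * (b + 1) : ℕ) : ℝ) *
                (2 * (aW' + aW) * (ρf⁻¹ ^ (a + 1) * (Real.exp 1 * ν₅) / (1 - Real.exp 1 * (aW' + aW + (aW' + aW)) * ν₅ / (κ' + κ) ^ 2)) *
                  (ρf⁻¹ ^ (b + 1) * (Real.exp 1 * ν₅) / (1 - Real.exp 1 * (aW' + aW + (aW' + aW)) * ν₅ / (κ' + κ) ^ 2))) else 0)) * (Λ * ((R' : ℝ) + 1))⁻¹ := by
  -- abbreviations: the five norms, the sums of the constants
  set e : ℝ := Real.exp 1 with he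
  set X₁ : ℝ := normV Γ' κ' ρ' (fun m' => NV m' + (NW' m' + NV m')) with hX₁
  set X₂ : ℝ := normV Γ' κ' ρ' (fun m' => NW' m' + NV m') with hX₂
  set X₃ : ℝ := normV Γ' κ' ρ' NV with hX₃
  set X₄ : ℝ := normV Γ' (κ' + κ + (κ' + κ + (κ' + κ))) ρ₂ Nw with hX₄
  set X₅ : ℝ := normV Γ' (κ' + κ) ρf Nw with hX₅
  set XE : ℝ := normV Γ' κ' ρ' Ein with hXE
  set K₃ : ℝ := κ' + κ + (κ' + κ + (κ' + κ)) with hK₃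
  set A : ℝ := aW' + aW + (aW' + aW) with hA
  have he0 : 0 ≤ e := (Real.exp_pos 1).le
  have hA0 : 0 ≤ A := by rw [hA]; positivity
  have hK0 : 0 ≤ κ' + κ := add_nonneg hκ' hκ
  have hK₃0 : 0 ≤ K₃ := by rw [hK₃]; positivity
  -- signs of the norms
  have hX₁0 : 0 ≤ X₁ := normV_nonneg hκ' hρ'.le fun m' => by linarith [hNV m', hNW' m']
  have hX₂0 : 0 ≤ X₂ := normV_nonneg hκ' hρ'.le fun m' => by linarith [hNV m', hNW' m']
  have hX₃0 : 0 ≤ X₃ := normV_nonneg hκ' hρ'.le hNV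
  have hX₄0 : 0 ≤ X₄ := normV_nonneg hK₃0 hρ₂.le hNw
  have hX₅0 : 0 ≤ X₅ := normV_nonneg hK0 hρf.le hNw
  have hXE0 : 0 ≤ XE := normV_nonneg hκ' hρ'.le hEin
  have hν₂0 : 0 ≤ ν₂ := hX₂0.trans hν₂
  have hν₄0 : 0 ≤ ν₄ := hX₄0.trans hν₄
  have hν₅0 : 0 ≤ ν₅ := hX₅0.trans hν₅
  -- the smallness numbers are monotone in the norms
  have hθ₁le : e * aW' * (X₁ + νEbar) / κ' ^ 2 ≤ e * aW' * (ν₁ + νEbar) / κ' ^ 2 := by gcongr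
  have hθ₂le : e * aW' * (X₃ + X₂) / κ' ^ 2 ≤ e * aW' * (ν₃ + ν₂) / κ' ^ 2 := by gcongr
  have hθ₃le : e * A * X₄ / K₃ ^ 2 ≤ e * A * ν₄ / K₃ ^ 2 := by gcongr
  have hθfle : e * A * X₅ / (κ' + κ) ^ 2 ≤ e * A * ν₅ / (κ' + κ) ^ 2 := by gcongr
  -- the sources are nonnegative
  have hS₂ : 0 ≤ (1 + Λ * ((R' : ℝ) + 1))⁻¹ := by positivity
  have hS₃ : 0 ≤ eW' / (1 + Λ * ((R : ℝ) + 1)) := by positivity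
  have hS₄ : 0 ≤ aW' / (1 + Λ * ((R : ℝ) + 1)) := by positivity
  have hS₅ : 0 ≤ (Λ * ((R' : ℝ) + 1))⁻¹ := by positivity
  -- the single brackets `G_k = ρ⁻ᵏ·e·X/(1−θ)` are nonnegative and monotone
  have hG : ∀ k : ℕ, 0 ≤ ρ₂⁻¹ ^ k * (e * X₄) / (1 - e * A * X₄ / K₃ ^ 2) ∧
      ρ₂⁻¹ ^ k * (e * X₄) / (1 - e * A * X₄ / K₃ ^ 2) ≤ ρ₂⁻¹ ^ k * (e * ν₄) / (1 - e * A * ν₄ / K₃ ^ 2) := by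
    intro k
    refine ⟨div_nonneg (by positivity) (by linarith), div_one_sub_mono (by positivity) ?_ hθ₃le hθ₃⟩
    gcongr
  have hF : ∀ k : ℕ, 0 ≤ ρf⁻¹ ^ k * (e * X₅) / (1 - e * A * X₅ / (κ' + κ) ^ 2) ∧
      ρf⁻¹ ^ k * (e * X₅) / (1 - e * A * X₅ / (κ' + κ) ^ 2) ≤ ρf⁻¹ ^ k * (e * ν₅) / (1 - e * A * ν₅ / (κ' + κ) ^ 2) := by
    intro k
    refine ⟨div_nonneg (by positivity) (by linarith), div_one_sub_mono (by positivity) ?_ hθfle hθf⟩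
    gcongr
  have hGb0 : ∀ k : ℕ, 0 ≤ ρ₂⁻¹ ^ k * (e * ν₄) / (1 - e * A * ν₄ / K₃ ^ 2) := fun k => (hG k).1.trans (hG k).2
  have hFb0 : ∀ k : ℕ, 0 ≤ ρf⁻¹ ^ k * (e * ν₅) / (1 - e * A * ν₅ / (κ' + κ) ^ 2) := fun k => (hF k).1.trans (hF k).2
  -- term 1
  have h1 : (ρ'⁻¹ ^ (n + 1) * e / (1 - e * aW' * (X₁ + νEbar) / κ' ^ 2) ^ 2) * XE ≤
      (ρ'⁻¹ ^ (n + 1) * e / (1 - e * aW' * (ν₁ + νEbar) / κ' ^ 2) ^ 2) * XE :=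
    mul_le_mul_of_nonneg_right (div_one_sub_sq_mono (by positivity) hθ₁le hθ₁) hXE0
  -- term 2
  have h2 : (ρ'⁻¹ ^ (n + 1) * (e * X₂) / (1 - e * aW' * (X₃ + X₂) / κ' ^ 2) ^ 2) * (1 + Λ * ((R' : ℝ) + 1))⁻¹ ≤
      (ρ'⁻¹ ^ (n + 1) * (e * ν₂) / (1 - e * aW' * (ν₃ + ν₂) / κ' ^ 2) ^ 2) * (1 + Λ * ((R' : ℝ) + 1))⁻¹ := by
    refine mul_le_mul_of_nonneg_right ?_ hS₂
    calc ρ'⁻¹ ^ (n + 1) * (e * X₂) / (1 - e * aW' * (X₃ + X₂) / κ' ^ 2) ^ 2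
        ≤ ρ'⁻¹ ^ (n + 1) * (e * ν₂) / (1 - e * aW' * (X₃ + X₂) / κ' ^ 2) ^ 2 := by
          refine div_le_div_of_nonneg_right ?_ (sq_nonneg _); gcongr
      _ ≤ ρ'⁻¹ ^ (n + 1) * (e * ν₂) / (1 - e * aW' * (ν₃ + ν₂) / κ' ^ 2) ^ 2 := div_one_sub_sq_mono (by positivity) hθ₂le hθ₂
  -- term 3
  have h3 : ((((n + 1 + 1) * (n + 1 + 2) : ℕ) : ℝ) / 2 * (ρ₂⁻¹ ^ (n + 3) * (e * X₄) / (1 - e * A * X₄ / K₃ ^ 2))) * (eW' / (1 + Λ * ((R : ℝ) + 1))) ≤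
      ((((n + 1 + 1) * (n + 1 + 2) : ℕ) : ℝ) / 2 * (ρ₂⁻¹ ^ (n + 3) * (e * ν₄) / (1 - e * A * ν₄ / K₃ ^ 2))) * (eW' / (1 + Λ * ((R : ℝ) + 1))) :=
    mul_le_mul_of_nonneg_right (mul_le_mul_of_nonneg_left (hG (n + 3)).2 (by positivity)) hS₃
  -- term 4
  have h4 : (‖(2 : ℂ)⁻¹‖ * ∑ a ∈ range (n + 2), ∑ b ∈ range (n + 2),
        (if a + b = n + 1 then (((a + 1) * (b + 1) : ℕ) : ℝ) *
          (4 * (ρ₂⁻¹ ^ (a + 1) * (e * X₄) / (1 - e * A * X₄ / K₃ ^ 2)) * (ρ₂⁻¹ ^ (b + 1) * (e * X₄) / (1 - e * A * X₄ / K₃ ^ 2))) else 0)) *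
        (aW' / (1 + Λ * ((R : ℝ) + 1))) ≤
      (‖(2 : ℂ)⁻¹‖ * ∑ a ∈ range (n + 2), ∑ b ∈ range (n + 2),
        (if a + b = n + 1 then (((a + 1) * (b + 1) : ℕ) : ℝ) *
          (4 * (ρ₂⁻¹ ^ (a + 1) * (e * ν₄) / (1 - e * A * ν₄ / K₃ ^ 2)) * (ρ₂⁻¹ ^ (b + 1) * (e * ν₄) / (1 - e * A * ν₄ / K₃ ^ 2))) else 0)) *
        (aW' / (1 + Λ * ((R : ℝ) + 1))) := by
    refine mul_le_mul_of_nonneg_right (mul_le_mul_of_nonneg_left (sum_le_sum fun a _ => sum_le_sum fun b _ => ?_) (norm_nonneg _)) hS₄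
    split_ifs
    · refine mul_le_mul_of_nonneg_left ?_ (by positivity)
      exact mul_le_mul (mul_le_mul_of_nonneg_left (hG _).2 (by norm_num)) (hG _).2 (hG _).1 (mul_nonneg (by norm_num) (hGb0 _))
    · exact le_rfl
  -- term 5
  have h5 : ((((n + 1 + 1) * (n + 1 + 2) : ℕ) : ℝ) / 2 * (sW' + sW) * (ρf⁻¹ ^ (n + 3) * (e * X₅) / (1 - e * A * X₅ / (κ' + κ) ^ 2)) +
        ‖(2 : ℂ)⁻¹‖ * ∑ a ∈ range (n + 2), ∑ b ∈ range (n + 2),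
          (if a + b = n + 1 then (((a + 1) * (b + 1) : ℕ) : ℝ) *
            (2 * (aW' + aW) * (ρf⁻¹ ^ (a + 1) * (e * X₅) / (1 - e * A * X₅ / (κ' + κ) ^ 2)) *
              (ρf⁻¹ ^ (b + 1) * (e * X₅) / (1 - e * A * X₅ / (κ' + κ) ^ 2))) else 0)) * (Λ * ((R' : ℝ) + 1))⁻¹ ≤
      ((((n + 1 + 1) * (n + 1 + 2) : ℕ) : ℝ) / 2 * (sW' + sW) * (ρf⁻¹ ^ (n + 3) * (e * ν₅) / (1 - e * A * ν₅ / (κ' + κ) ^ 2)) +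
        ‖(2 : ℂ)⁻¹‖ * ∑ a ∈ range (n + 2), ∑ b ∈ range (n + 2),
          (if a + b = n + 1 then (((a + 1) * (b + 1) : ℕ) : ℝ) *
            (2 * (aW' + aW) * (ρf⁻¹ ^ (a + 1) * (e * ν₅) / (1 - e * A * ν₅ / (κ' + κ) ^ 2)) *
              (ρf⁻¹ ^ (b + 1) * (e * ν₅) / (1 - e * A * ν₅ / (κ' + κ) ^ 2))) else 0)) * (Λ * ((R' : ℝ) + 1))⁻¹ := by
    refine mul_le_mul_of_nonneg_right (add_le_add (mul_le_mul_of_nonneg_left (hF (n + 3)).2 (by positivity))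
      (mul_le_mul_of_nonneg_left (sum_le_sum fun a _ => sum_le_sum fun b _ => ?_) (norm_nonneg _))) hS₅
    split_ifs
    · refine mul_le_mul_of_nonneg_left ?_ (by positivity)
      exact mul_le_mul (mul_le_mul_of_nonneg_left (hF _).2 (by positivity)) (hF _).2 (hF _).1 (mul_nonneg (by positivity) (hFb0 _))
    · exact le_rfl
  exact add_le_add (add_le_add (add_le_add (add_le_add h1 h2) h3) h4) h5

end Summit.HubbardSuperconductivity.HubbardSuperconductivity.Theorems.TwoVolumeDefect

end
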